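import Summits.CriticalPhenomena.PercolationContinuityZ3.Theorems.PercNearOneGluingNoHeavyLowerTailSahiCombVennThree
import Summits.CriticalPhenomena.PercolationContinuityZ3.Theorems.PercNearOneGluingNoHeavyLowerTailSahiC4CombBridge
import Summits.CriticalPhenomena.PercolationContinuityZ3.Theorems.PercNearOneGluingNoHeavyLowerTailSahiCombRange

/-!
# The comb (tensor-Bernstein) hierarchy for Sahi's `E_k`, XIX: an ORDER-4 row inside the hard core — (M⁺-4), and then EVERY order, for
# quadruples of unions of independent events with PAIRWISE sharing, from ONE kernel certificate on six coins (the edge cube of `K₄`)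

Support file of the one-cut programme (crux `NoHeavyLowerTail`, stmt-CriticalPhenomena-4575; cell `prim-masterthm`, seat P3, gen 4;
`run/shared/lean/prim/prim-masterthm/prim-masterthm-p3/HIERARCHY.md` §11).  Vocabulary: `SahiComb.CombPos`; the read-once substitution theorem
`SahiCombReadOnce.CombPos.readOnce`; gen-1's four-copy digit certificate `SahiC4Cube.checkQuad` with `e4Coef_nonneg_of_checkQuad` and the bridge
`SahiC4CombBridge.combPos_of_e4Coef_nonneg`; range lifting `SahiCombRange.combPos_sahiE_ind_of_range_four` (gen 4).

THE POINT (order-4 analogue of `…SahiCombVennThree`).  Four events `U_k = ⋃_{a ∈ A_k} H_a` (`k < 4`) built from independent events `H_a` such that EVERY `a` LIES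
IN EXACTLY TWO of the `A_k` are the read-once image of the fixed quadruple `B_k = {ξ ⊆ 6 | ∃ r ∈ ξ, k ∈ pair(r)}` on the SIX-point cube indexed by the
pairs of `{0,1,2,3}` (the edges of `K₄`; `B_k` = "some edge at vertex `k` is open").  Comb positivity of `E_4(1_{B_0},…,1_{B_3})` is a kernel-checked digit
certificate (`decide`, all `5^6 = 15 625` four-copy fibre sums `≥ 0`; census: `7 264` zero, interior minimum `38`), so (M⁺-4) holds for the whole class; with
`…SahiCombVennThree` for the sub-triples and range lifting, every family drawn from such a quadruple is comb-positive at EVERY order.  The full order-4 Venn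
template (all `11` non-singleton tiles of `{0,1,2,3}`, i.e. arbitrary sharing) is comb-positive at census level (`48 828 125` coefficients, `0` negative,
HIERARCHY §11) but beyond the kernel's reach with this certificate format.
* `certs_pairs` — the six-coin certificate (kernel `decide`; member `k` of the base quadruple contains the point `x < 64` iff `x` meets the mask `![7,25,42,52] k` of
  the pairs `01,02,03,12,13,23` containing `k`); `encA_pairBase`, `combPos_sahiE_four_pairBase` — (M⁺-4) for the base quadruple `{ξ | ∃ r ∈ ξ, k ∈ pair r}`;
* **`combPos_sahiE_four_pairs`** — for gadgets `G r` (`r : Fin 6`) determined by the fibres of any `π : ι → Fin 6`, the quadruple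
  `(⋃_{r : k ∈ pair r} G r)_{k<4}` has `E_4` comb-positive at multidegree `4`;
* **`combPos_sahiE_four_unions_pairwise`** — for every finite independent family `(H_a)` (pairwise disjoint determining sets, not necessarily monotone)
  and `A_0,…,A_3` with every `a` in exactly two of them: (M⁺-4) for `(⋃_{A_k} H)_k`; law-level shadow;
* **`combPos_sahiE_ind_unions_pairwise`** — for increasing `H_a`: every family drawn (with repetitions) from these four unions is comb-positive at its
  size, every size (e.g. the non-isolation events of the four vertices of a multigraph on four vertices with independent edges, at all orders).
HONEST FRAMING: nothing here asserts (M⁺-k) or `C_k` for `k ≥ 3` in general. [this work]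
-/

noncomputable section

open scoped Classical

namespace Summit.CriticalPhenomena.PercolationContinuityZ3.Theorems

open Finset Function
open Literature.Combinatorics.Sahi2008
open Literature.Probability.Percolation (DeterminedBy determinedBy_iff)
open Literature.Probability.Percolation.DecisionTree (ind)
open SahiComb SahiCombReadOnce SahiC3Cube SahiC4Cube

namespace SahiCombVennFour

/-! ### The six-coin certificate -/

/-- **The six-coin certificate** (kernel `decide`, ≈ 4 s): the four-copy digit test of the base quadruple passes. [this work] -/
theorem certs_pairs :
    checkQuad 30 6 (ofBits (fun x => decide (x &&& (![7, 25, 42, 52] : Fin 4 → ℕ) 0 ≠ 0)) (2 ^ 6)) (ofBits (fun x => decide (x &&& (![7, 25, 42, 52] : Fin 4 → ℕ) 1 ≠ 0)) (2 ^ 6))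
      (ofBits (fun x => decide (x &&& (![7, 25, 42, 52] : Fin 4 → ℕ) 2 ≠ 0)) (2 ^ 6)) (ofBits (fun x => decide (x &&& (![7, 25, 42, 52] : Fin 4 → ℕ) 3 ≠ 0)) (2 ^ 6)) = true := by
  decide +kernel

/-- Membership in the base events as a mask test (kernel `decide`). [this work] -/
theorem pairBase_mem : ∀ (k : Fin 4) (x : ℕ), x < 2 ^ 6 →
    ((∃ r : Fin 6, x.testBit r = true ∧ ((![7, 25, 42, 52] : Fin 4 → ℕ) k).testBit r = true) ↔ decide (x &&& (![7, 25, 42, 52] : Fin 4 → ℕ) k ≠ 0) = true) := by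
  decide

/-- The base events have the announced bitmasks. [this work] -/
theorem encA_pairBase (k : Fin 4) : encA 6 ({ξ : Set (Fin 6) | ∃ r ∈ ξ, ((![7, 25, 42, 52] : Fin 4 → ℕ) k).testBit r = true}) = ofBits (fun x => decide (x &&& (![7, 25, 42, 52] : Fin 4 → ℕ) k ≠ 0)) (2 ^ 6) := by
  refine SahiCombVenn.encA_eq_ofBits _ fun x hx => ?_
  simpa only [Set.mem_setOf_eq, pt, exists_prop] using pairBase_mem k x hx

/-- **(M⁺-4) for the base quadruple on `{0,1}^6`.** [this work] -/
theorem combPos_sahiE_four_pairBase :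
    CombPos (fun _ : Fin 6 => 4) (fun p => sahiE (bernoulliWeight p) 4 (fun k => ind ({ξ : Set (Fin 6) | ∃ r ∈ ξ, ((![7, 25, 42, 52] : Fin 4 → ℕ) k).testBit r = true}))) := by
  have h := SahiC4CombBridge.combPos_of_e4Coef_nonneg (m := 6)
    (A := {ξ : Set (Fin 6) | ∃ r ∈ ξ, ((![7, 25, 42, 52] : Fin 4 → ℕ) 0).testBit r = true})
    (B := {ξ : Set (Fin 6) | ∃ r ∈ ξ, ((![7, 25, 42, 52] : Fin 4 → ℕ) 1).testBit r = true})
    (C := {ξ : Set (Fin 6) | ∃ r ∈ ξ, ((![7, 25, 42, 52] : Fin 4 → ℕ) 2).testBit r = true})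
    (D := {ξ : Set (Fin 6) | ∃ r ∈ ξ, ((![7, 25, 42, 52] : Fin 4 → ℕ) 3).testBit r = true})
    (SahiC4Cube.e4Coef_nonneg_of_checkQuad (σ := 30) (by rw [encA_pairBase, encA_pairBase, encA_pairBase, encA_pairBase]; exact certs_pairs))
  refine h.congr fun p => ?_
  congr 1; funext k; fin_cases k <;> rfl

/-! ### Read-once transfer -/

variable {ι : Type} [Fintype ι]

omit [Fintype ι] in
/-- Substituting gadgets into a base event gives the union of the gadgets at the pairs containing `k`. [this work] -/
theorem readOnce_pairBase (G : Fin 6 → Set (Set ι)) (k : Fin 4) :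
    {ω : Set ι | {r | ω ∈ G r} ∈ {ξ : Set (Fin 6) | ∃ r ∈ ξ, ((![7, 25, 42, 52] : Fin 4 → ℕ) k).testBit r = true}} = ⋃ (r : Fin 6) (_ : ((![7, 25, 42, 52] : Fin 4 → ℕ) k).testBit r = true), G r := by
  ext ω
  simp only [Set.mem_setOf_eq, Set.mem_iUnion, exists_prop]
  constructor <;> rintro ⟨r, h1, h2⟩ <;> exact ⟨r, h2, h1⟩

/-- **(M⁺-4) for pairwise-sharing patterns of independent gadgets.**  For gadgets `G r` (`r : Fin 6`) determined by the fibres of `π : ι → Fin 6`, the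
quadruple whose member `k` is the union of the gadgets `G r` over the pairs `r ∋ k` has `E_4` comb-positive at multidegree `4`. [this work] -/
theorem combPos_sahiE_four_pairs (π : ι → Fin 6) (G : Fin 6 → Set (Set ι)) (hG : ∀ r, DeterminedBy (G r) {i | π i = r}) :
    CombPos (fun _ : ι => 4) (fun q => sahiE (bernoulliWeight q) 4 (fun k => ind (⋃ (r : Fin 6) (_ : ((![7, 25, 42, 52] : Fin 4 → ℕ) k).testBit r = true), G r))) := by
  refine (CombPos.readOnce π G hG combPos_sahiE_four_pairBase).congr fun q => ?_
  congr 1; funext k; rw [readOnce_pairBase]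

/-! ### Unions of an arbitrary independent family with pairwise sharing -/

section Unions

variable {A : Type} [Fintype A]

omit [Fintype A] in
/-- The pair index of the code `[a ∈ A_0] + 2[a ∈ A_1] + 4[a ∈ A_2] + 8[a ∈ A_3]` of an index lying in exactly two of the `A_k`, and its bits:
for each such `a`, bit `pairIdx a` of `(![7, 25, 42, 52] : Fin 4 → ℕ) k` is set iff `a ∈ A_k` (sixteen membership cases, `decide`). [this work] -/
theorem exists_pairIdx [DecidableEq A] (𝒜 : Fin 4 → Finset A) (a : A) (h2 : (univ.filter fun k => a ∈ 𝒜 k).card = 2) :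
    ∃ r : Fin 6, ∀ k : Fin 4, ((![7, 25, 42, 52] : Fin 4 → ℕ) k).testBit r = true ↔ a ∈ 𝒜 k := by
  have key : ∀ b₀ b₁ b₂ b₃ : Bool, (univ.filter fun k : Fin 4 => (![b₀, b₁, b₂, b₃] k) = true).card = 2 →
      ∃ r : Fin 6, ∀ k : Fin 4, ((![7, 25, 42, 52] : Fin 4 → ℕ) k).testBit r = true ↔ (![b₀, b₁, b₂, b₃] k) = true := by decide
  obtain ⟨r, hr⟩ := key (decide (a ∈ 𝒜 0)) (decide (a ∈ 𝒜 1)) (decide (a ∈ 𝒜 2)) (decide (a ∈ 𝒜 3)) (by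
    convert h2 using 2; ext k; fin_cases k <;> simp)
  exact ⟨r, fun k => by rw [hr k]; fin_cases k <;> simp⟩

/-- **(M⁺-4) FOR UNIONS OF INDEPENDENT EVENTS WITH PAIRWISE SHARING.**  Let `(H_a)_{a ∈ A}` be events determined by pairwise disjoint coordinate sets (no
monotonicity needed) and `A_0,…,A_3 ⊆ A` such that every `a` lies in EXACTLY TWO of the `A_k`.  Then `q ↦ E_4(μ_q; 1_{⋃_{A_0} H},…,1_{⋃_{A_3} H})` is a
nonnegative combination of the degree-4 tensor-Bernstein basis on `[0,1]^ι`. [this work] -/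
theorem combPos_sahiE_four_unions_pairwise (H : A → Set (Set ι)) (D : A → Finset ι) (hD : ∀ a b, a ≠ b → Disjoint (D a) (D b))
    (hH : ∀ a, DeterminedBy (H a) (↑(D a) : Set ι)) (𝒜 : Fin 4 → Finset A) (h2 : ∀ a, (univ.filter fun k => a ∈ 𝒜 k).card = 2) :
    CombPos (fun _ : ι => 4) (fun q => sahiE (bernoulliWeight q) 4 (fun k => ind (⋃ a ∈ 𝒜 k, H a))) := by
  classical
  choose code hcode using fun a => exists_pairIdx 𝒜 a (h2 a)
  -- the projection `π` (owner's pair index) and the six gadgets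
  let π : ι → Fin 6 := fun i => if h : ∃ a, i ∈ D a then code h.choose else 0
  let G : Fin 6 → Set (Set ι) := fun r => ⋃ (a : A) (_ : code a = r), H a
  have howner : ∀ {i a}, i ∈ D a → π i = code a := by
    intro i a hi
    have hex : ∃ a, i ∈ D a := ⟨a, hi⟩
    have hπ : π i = code hex.choose := dif_pos hex
    have ha : hex.choose = a := by
      by_contra hne
      exact Finset.disjoint_left.1 (hD _ _ hne) hex.choose_spec hi
    rw [hπ, ha]
  have hG : ∀ r, DeterminedBy (G r) {i | π i = r} := by
    intro r
    rw [determinedBy_iff]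
    intro ω ω' hωω'
    simp only [G, Set.mem_iUnion, exists_prop]
    refine exists_congr fun a => and_congr_right fun hca => ?_
    refine (determinedBy_iff _ _).1 (hH a) ω ω' ?_
    have hsub : (↑(D a) : Set ι) ⊆ {i | π i = r} := fun i hi => by
      simp only [Set.mem_setOf_eq, howner (Finset.mem_coe.1 hi), hca]
    rw [← Set.inter_eq_self_of_subset_right hsub, ← Set.inter_assoc, ← Set.inter_assoc, hωω']
  have h := combPos_sahiE_four_pairs π G hG
  refine h.congr fun q => ?_
  congr 1; funext k; congr 1
  ext ω
  simp only [G, Set.mem_iUnion, exists_prop]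
  constructor
  · rintro ⟨a, ha, hω⟩
    exact ⟨code a, (hcode a k).2 ha, a, rfl, hω⟩
  · rintro ⟨r, hr, a, hca, hω⟩
    exact ⟨a, (hcode a k).1 (by rw [hca]; exact hr), hω⟩

/-- Law-level shadow: Sahi's `E_4(μ_q) ≥ 0` for quadruples of unions of independent events with pairwise sharing, every product measure. [this work] -/
theorem sahiE_four_nonneg_unions_pairwise (q : ι → unitInterval) (H : A → Set (Set ι)) (D : A → Finset ι)
    (hD : ∀ a b, a ≠ b → Disjoint (D a) (D b)) (hH : ∀ a, DeterminedBy (H a) (↑(D a) : Set ι)) (𝒜 : Fin 4 → Finset A)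
    (h2 : ∀ a, (univ.filter fun k => a ∈ 𝒜 k).card = 2) :
    0 ≤ sahiE (bernoulliWeight q) 4 (fun k => ind (⋃ a ∈ 𝒜 k, H a)) :=
  (combPos_sahiE_four_unions_pairwise H D hD hH 𝒜 h2).nonneg q

/-- **EVERY ORDER for families drawn from four unions of independent increasing events with pairwise sharing.**  With `H_a` increasing: for every `n` and
every `s : Fin n → Fin 4`, the family `(⋃_{a ∈ A_{s(j)}} H_a)_{j<n}` has `E_n(μ_q)` comb-positive at multidegree `n` (quartic row above, cubic rows by
`…SahiCombVennThree`, range lifting). [this work] -/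
theorem combPos_sahiE_ind_unions_pairwise (H : A → Set (Set ι)) (hHup : ∀ a, IsUpperSet (H a)) (D : A → Finset ι)
    (hD : ∀ a b, a ≠ b → Disjoint (D a) (D b)) (hH : ∀ a, DeterminedBy (H a) (↑(D a) : Set ι)) (𝒜 : Fin 4 → Finset A)
    (h2 : ∀ a, (univ.filter fun k => a ∈ 𝒜 k).card = 2) {n : ℕ} (s : Fin n → Fin 4) :
    CombPos (fun _ : ι => n) (fun q => sahiE (bernoulliWeight q) n (fun j => ind (⋃ a ∈ 𝒜 (s j), H a))) :=
  SahiCombRange.combPos_sahiE_ind_of_range_four (fun k => ⋃ a ∈ 𝒜 k, H a) (fun _ => isUpperSet_iUnion₂ fun a _ => hHup a)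
    (fun j => ⋃ a ∈ 𝒜 (s j), H a) (fun j => ⟨s j, rfl⟩)
    (fun φ => (SahiCombVenn.combPos_sahiE_three_unions H D hD hH (fun l => 𝒜 (φ l))).congr fun _ => rfl)
    (combPos_sahiE_four_unions_pairwise H D hD hH 𝒜 h2)

/-- Law-level shadow: Sahi's `E_n(μ_q) ≥ 0`, every `n`, for families drawn from four unions of independent increasing events with pairwise sharing.
[this work] -/
theorem sahiE_ind_nonneg_unions_pairwise (q : ι → unitInterval) (H : A → Set (Set ι)) (hHup : ∀ a, IsUpperSet (H a)) (D : A → Finset ι)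
    (hD : ∀ a b, a ≠ b → Disjoint (D a) (D b)) (hH : ∀ a, DeterminedBy (H a) (↑(D a) : Set ι)) (𝒜 : Fin 4 → Finset A)
    (h2 : ∀ a, (univ.filter fun k => a ∈ 𝒜 k).card = 2) {n : ℕ} (s : Fin n → Fin 4) :
    0 ≤ sahiE (bernoulliWeight q) n (fun j => ind (⋃ a ∈ 𝒜 (s j), H a)) :=
  (combPos_sahiE_ind_unions_pairwise H hHup D hD hH 𝒜 h2 s).nonneg q

end Unions

end SahiCombVennFour

end Summit.CriticalPhenomena.PercolationContinuityZ3.Theorems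

end
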